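import Summits.AtomisticToContinuum.HydrodynamicLimit.Theorems.CollisionIsometryCLTAdaptedWeightCLTTLStubDuhamel
import Summits.AtomisticToContinuum.HydrodynamicLimit.Theorems.AdaptedWeightCLT.Negative.CubicProbeDeficiency

/-!
# Stub `stub_pastDamping` of the line `contact-source-duhamel` — helper file 1/n: exact algebra of PAST
(crux `CollisionIsometryCLT.AdaptedWeightCLT`, stmt-AtomisticToContinuum-14868, `--supports`)

The exact (dynamics-free, measure-free) algebra behind the PAST DAMPING estimate of the line, over
the objects of `Theorems/CollisionIsometryCLTAdaptedWeightCLTLine.lean`, on top of the one-step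
lemmas of `…TLStubDuhamel.lean` (`Duhamel.mapT_add`, `tStep_of_none/_of_some/_add/_zero/_sum`,
`tTransport_zero/_succ`) and the tensor bookkeeping of
`Theorems/AdaptedWeightCLT/Negative/CubicProbeDeficiency.lean` (`AdaptedWeightCLTNegative.sum_index_two`,
`tpow_two/three_apply`, `tpow_smul`, `baseV_apply`, `pairT_smul`, `tpow_three_polarization`), both
imported:

* linearity of the pairing `pairT C ·`, of the slot action `mapT M`, of one transport step `tStep`
  and of the window transport `tTransport` in the tensor family (`tTransport_add/_smul/_sum`), whence
  the SITE DECOMPOSITION of the transport (`tTransport_eq_sum_single`: `𝒯 T = Σ_k 𝒯 (δ_k T_k)`) and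
  of PAST (`pastF_eq_sum_sites`:
  `PAST(C) = (N+1)⁻¹ Σ_k Σ_i w_i ⟨C, 𝒯(δ_k ((y_k).2 − u)^{⊗r})_i⟩`, the file's registered anchor);
* TRACELESSNESS of the stress tests against the depolarised value: `pairT (C2 j k) (iso2 a) = 0`
  (`pairT_C2_iso2`) — this is where rank-2 column depolarisation enters PAST;
* RANK-2 POLARISATION over the six probe impulses `dirV p q` of `cd2` (`tpow_two_polarization`:
  `y ⊗ y = Σ_{p,q} c₂(y)_{pq} • (dirV p q)^{⊗2}`, `|c₂(y)_{pq}| ≤ 5‖y‖²`), and RANK-3 POLARISATION over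
  the ten cubic-unisolvent impulses `udir` of `cd3x` (`tpow_three_eq_sum_udir`:
  `y^{⊗3} = Σ_p c₃(y)_p • (udir p)^{⊗3}`, `|c₃(y)_p| ≤ 3‖y‖³` — the one-sum form of
  `AdaptedWeightCLTNegative.tpow_three_polarization`), so that by linearity the probed clouds control
  `𝒯(δ_k y_k^{⊗r})` for every window-start velocity `y_k`.
-/

namespace Summit.AtomisticToContinuum.HydrodynamicLimit.Theorems.ContactSourceDuhamel.TimeLocal
namespace PastDamping

open scoped BigOperators Topology Classical MeasureTheory ENNReal InnerProductSpace
open Filter Set MeasureTheory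
open Duhamel
open Summit.AtomisticToContinuum.HydrodynamicLimit.Theorems.AdaptedWeightCLTNegative

noncomputable section

variable {σ : ℝ} {N : ℕ} {y : Cfg N} {r : ℕ}

/-! ## Pairings and the slot action are linear -/

/-- `pairT C` is additive. -/
theorem pairT_add_right (C A B : Tens r) : pairT C (A + B) = pairT C A + pairT C B := by
  simp only [pairT, Pi.add_apply, mul_add, Finset.sum_add_distrib]

/-- `pairT C 0 = 0`. -/
theorem pairT_zero_right (C : Tens r) : pairT C 0 = 0 := by
  simp [pairT]

/-- `pairT C` commutes with finite sums. -/
theorem pairT_sum_right {ι : Type*} (C : Tens r) (s : Finset ι) (A : ι → Tens r) :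
    pairT C (∑ l ∈ s, A l) = ∑ l ∈ s, pairT C (A l) :=
  map_sum (⟨⟨pairT C, pairT_zero_right C⟩, pairT_add_right C⟩ : Tens r →+ ℝ) A s

/-- `pairT C` of a difference. -/
theorem pairT_sub_right (C A B : Tens r) : pairT C (A - B) = pairT C A - pairT C B := by
  simp only [pairT, Pi.sub_apply, mul_sub, Finset.sum_sub_distrib]

/-- `mapT M` is homogeneous. -/
theorem mapT_smul (M : Mat3) (c : ℝ) (A : Tens r) : mapT M (c • A) = c • mapT M A := by
  funext idx
  simp only [mapT, Pi.smul_apply, smul_eq_mul, Finset.mul_sum]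
  exact Finset.sum_congr rfl fun _ _ => by ring

/-- `mapT M 0 = 0`. -/
theorem mapT_zero (M : Mat3) : mapT M (0 : Tens r) = 0 := by
  funext idx
  simp [mapT]

/-! ## One transport step and the window transport are linear in the tensor family -/

/-- `tStep` is homogeneous in the tensor family. -/
theorem tStep_smul (k : ℕ) (c : ℝ) (F : Fin (N + 1) → Tens r) :
    tStep r σ N y k (c • F) = c • tStep r σ N y k F := by
  rcases h : stepPair σ N y k with _ | ⟨p, q⟩
  · simp only [tStep_of_none h]
  · simp only [tStep_of_some h]
    funext i
    simp only [Function.update_apply, Pi.smul_apply, mapT_smul]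
    split_ifs <;> simp [smul_add]

/-- The window transport is additive in the tensor family. -/
theorem tTransport_add (m₁ n : ℕ) (F F' : Fin (N + 1) → Tens r) :
    tTransport r σ N y m₁ n (F + F') = tTransport r σ N y m₁ n F + tTransport r σ N y m₁ n F' := by
  induction n with
  | zero => simp only [tTransport_zero]
  | succ n ih => rw [tTransport_succ, tTransport_succ, tTransport_succ, ih, tStep_add]

/-- The window transport is homogeneous in the tensor family. -/
theorem tTransport_smul (m₁ n : ℕ) (c : ℝ) (F : Fin (N + 1) → Tens r) :
    tTransport r σ N y m₁ n (c • F) = c • tTransport r σ N y m₁ n F := by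
  induction n with
  | zero => simp only [tTransport_zero]
  | succ n ih => rw [tTransport_succ, tTransport_succ, ih, tStep_smul]

/-- The window transport kills the zero family. -/
theorem tTransport_zero_family (m₁ n : ℕ) :
    tTransport r σ N y m₁ n (0 : Fin (N + 1) → Tens r) = 0 := by
  have h := tTransport_smul (r := r) (σ := σ) (y := y) m₁ n 0 0
  rwa [zero_smul, zero_smul] at h

/-- The window transport commutes with finite sums of tensor families. -/
theorem tTransport_sum {ι : Type*} (m₁ n : ℕ) (s : Finset ι) (F : ι → Fin (N + 1) → Tens r) :
    tTransport r σ N y m₁ n (∑ l ∈ s, F l) = ∑ l ∈ s, tTransport r σ N y m₁ n (F l) :=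
  map_sum (⟨⟨tTransport r σ N y m₁ n, tTransport_zero_family m₁ n⟩, tTransport_add m₁ n⟩ :
    (Fin (N + 1) → Tens r) →+ (Fin (N + 1) → Tens r)) F s

/-- SITE DECOMPOSITION of the incoherent transport: a family is the sum of its one-site families,
so `𝒯 T = Σ_k 𝒯 (δ_k T_k)`. -/
theorem tTransport_eq_sum_single (m₁ n : ℕ) (T : Fin (N + 1) → Tens r) :
    tTransport r σ N y m₁ n T = ∑ k : Fin (N + 1), tTransport r σ N y m₁ n (Pi.single k (T k)) := by
  rw [← tTransport_sum]
  congr 1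
  exact (Finset.univ_sum_single T).symm

/-- The one-site transport is homogeneous in the injected tensor. -/
theorem tTransport_single_smul (m₁ n : ℕ) (k : Fin (N + 1)) (c : ℝ) (A : Tens r) :
    tTransport r σ N y m₁ n (Pi.single k (c • A)) = c • tTransport r σ N y m₁ n (Pi.single k A) := by
  rw [← tTransport_smul, Pi.single_smul]

/-- The one-site transport is additive in the injected tensor. -/
theorem tTransport_single_add (m₁ n : ℕ) (k : Fin (N + 1)) (A B : Tens r) :
    tTransport r σ N y m₁ n (Pi.single k (A + B)) =
      tTransport r σ N y m₁ n (Pi.single k A) + tTransport r σ N y m₁ n (Pi.single k B) := by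
  rw [← tTransport_add, Pi.single_add]

/-- The one-site transport commutes with finite sums of injected tensors. -/
theorem tTransport_single_sum {ι : Type*} (m₁ n : ℕ) (k : Fin (N + 1)) (s : Finset ι)
    (A : ι → Tens r) :
    tTransport r σ N y m₁ n (Pi.single k (∑ l ∈ s, A l)) =
      ∑ l ∈ s, tTransport r σ N y m₁ n (Pi.single k (A l)) := by
  induction s using Finset.induction_on with
  | empty => simp only [Finset.sum_empty, Pi.single_zero, tTransport_zero_family]
  | @insert a s ha ih => rw [Finset.sum_insert ha, Finset.sum_insert ha, tTransport_single_add, ih]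

/-- **PAST, site by site.** `pastF r … m w u C = (N+1)⁻¹ Σ_k Σ_i w_i ⟨C, 𝒯_{0→m}(δ_k ((y_k).2 − u)^{⊗r})_i⟩`:
PAST is the sum over injection sites `k` of the weighted pairing of the test with the transported
one-site power (the cloud of `k`, read carrier by carrier with the block weights). -/
theorem pastF_eq_sum_sites (r : ℕ) (σ : ℝ) (N : ℕ) (y : Cfg N) (m : ℕ) (w : Fin (N + 1) → ℝ)
    (u : V3) (C : Tens r) :
    pastF r σ N y m w u C = ((N + 1 : ℕ) : ℝ)⁻¹ * ∑ k : Fin (N + 1), ∑ i : Fin (N + 1),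
      w i * pairT C (tTransport r σ N y 0 m (Pi.single k (tpow r ((y k).2 - u))) i) := by
  rw [pastF, Finset.sum_comm]
  congr 1
  refine Finset.sum_congr rfl fun i _ => ?_
  rw [tTransport_eq_sum_single (r := r) (σ := σ) (y := y) 0 m (fun k => tpow r ((y k).2 - u)),
    Finset.sum_apply, pairT_sum_right, Finset.mul_sum]

/-- The cloud of the line is the carrier sum of the one-site transport (by definition). -/
theorem cloud_eq (r : ℕ) (σ : ℝ) (N : ℕ) (y : Cfg N) (m : ℕ) (k : Fin (N + 1)) (a : V3) :
    cloud r σ N y m k a = ∑ i : Fin (N + 1), tTransport r σ N y 0 m (Pi.single k (tpow r a)) i := rfl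

/-- Registered anchor of this helper file (the site decomposition of PAST, `pastF_eq_sum_sites`). -/
theorem pastDamping_algebra_anchor : ∀ (r : ℕ) (σ : ℝ) (N : ℕ) (y : Cfg N) (m : ℕ) (w : Fin (N + 1) → ℝ) (u : V3) (C : Tens r), pastF r σ N y m w u C = ((N + 1 : ℕ) : ℝ)⁻¹ * ∑ k : Fin (N + 1), ∑ i : Fin (N + 1), w i * pairT C (tTransport r σ N y 0 m (Pi.single k (tpow r ((y k).2 - u))) i) :=
  pastF_eq_sum_sites

/-! ## Tracelessness: the stress tests do not see the depolarised value -/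

/-- The stress tests `C2 j k` annihilate every multiple of the identity tensor. -/
theorem pairT_C2_diag (j k : Fin 3) (c : ℝ) :
    pairT (C2 j k) (fun idx => if idx 0 = idx 1 then c else 0) = 0 := by
  rw [pairT, sum_index_two]
  simp only [C2, Matrix.cons_val_zero, Matrix.cons_val_one, Fin.sum_univ_three]
  fin_cases j <;> fin_cases k <;> simp <;> ring

/-- **Tracelessness.** `⟨C2 j k, |a|² 𝟙/3⟩ = 0`: the traceless stress tests do not see the depolarised
rank-2 value `iso2 a` of an impulse cloud — the entry point of column depolarisation into PAST. -/
theorem pairT_C2_iso2 (j k : Fin 3) (a : V3) : pairT (C2 j k) (iso2 a) = 0 :=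
  pairT_C2_diag j k (‖a‖ ^ 2 / 3)

/-- Hence the stress tests read a cloud only through its deviation from the depolarised value. -/
theorem pairT_C2_eq_sub_iso2 (j k : Fin 3) (T : Tens 2) (a : V3) :
    pairT (C2 j k) T = pairT (C2 j k) (T - iso2 a) := by
  rw [pairT_sub_right, pairT_C2_iso2, sub_zero]

/-! ## Rank-2 polarisation over the six probe impulses `dirV p q` -/

/-- The squared norm of `e_p + e_q`: `4` on the diagonal, `2` off it. -/
theorem norm_baseV_add_sq (p q : Fin 3) :
    ‖baseV p + baseV q‖ ^ 2 = if p = q then 4 else 2 := by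
  rw [EuclideanSpace.real_norm_sq_eq, Fin.sum_univ_three]
  fin_cases p <;> fin_cases q <;> simp [baseV_apply] <;> norm_num

/-- The probe powers in rational form: `(dirV p q)^{⊗2} = ‖e_p + e_q‖⁻² • (e_p + e_q)^{⊗2}`. -/
theorem tpow_two_dirV (p q : Fin 3) :
    tpow 2 (dirV p q) = (‖baseV p + baseV q‖ ^ 2)⁻¹ • tpow 2 (baseV p + baseV q) := by
  rw [dirV, tpow_smul, inv_pow]

/-- The rank-2 polarisation coefficients of `y ⊗ y` over the probes `dirV p q`:
`2y_p² − y_p (y₀+y₁+y₂)` on the diagonal, `y_p y_q` off it. -/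
def c2coef (a : V3) (p q : Fin 3) : ℝ :=
  if p = q then 2 * a p ^ 2 - a p * (a 0 + a 1 + a 2) else a p * a q

/-- **Rank-2 polarisation.** `y ⊗ y = Σ_{p,q} c₂(y)_{pq} • (dirV p q)^{⊗2}`: every injected stress is a
combination of the six probed ones, so by linearity of the transport the six clouds of `cd2` control
`𝒯(δ_k y_k ⊗ y_k)`. -/
theorem tpow_two_polarization (a : V3) :
    tpow 2 a = ∑ p : Fin 3, ∑ q : Fin 3, c2coef a p q • tpow 2 (dirV p q) := by
  simp only [Fin.sum_univ_three, c2coef, tpow_two_dirV, norm_baseV_add_sq, smul_smul]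
  funext idx
  simp only [Pi.add_apply, Pi.smul_apply, smul_eq_mul, tpow_two_apply, PiLp.add_apply, baseV_apply]
  generalize idx 0 = i, idx 1 = j
  fin_cases i <;> fin_cases j <;> simp <;> ring

/-- The rank-2 polarisation coefficients are `≤ 5‖y‖²`. -/
theorem abs_c2coef_le (a : V3) (p q : Fin 3) : |c2coef a p q| ≤ 5 * ‖a‖ ^ 2 := by
  have hn := norm_nonneg a
  have hco : ∀ i : Fin 3, |a i| ≤ ‖a‖ := fun i => by
    rw [← Real.norm_eq_abs]; exact PiLp.norm_apply_le a i
  have hp := hco p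
  have hpp : |a p * a p| ≤ ‖a‖ * ‖a‖ := by
    rw [abs_mul]; exact mul_le_mul hp hp (abs_nonneg _) hn
  have hpq : |a p * a q| ≤ ‖a‖ * ‖a‖ := by
    rw [abs_mul]; exact mul_le_mul hp (hco q) (abs_nonneg _) hn
  unfold c2coef
  split_ifs with h
  · have hS : |a 0 + a 1 + a 2| ≤ 3 * ‖a‖ := by
      calc |a 0 + a 1 + a 2| ≤ |a 0| + |a 1| + |a 2| := abs_add_three _ _ _
        _ ≤ ‖a‖ + ‖a‖ + ‖a‖ := by linarith [hco 0, hco 1, hco 2]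
        _ = 3 * ‖a‖ := by ring
    have hpS : |a p * (a 0 + a 1 + a 2)| ≤ ‖a‖ * (3 * ‖a‖) := by
      rw [abs_mul]; exact mul_le_mul hp hS (abs_nonneg _) hn
    calc |2 * a p ^ 2 - a p * (a 0 + a 1 + a 2)|
        ≤ |2 * a p ^ 2| + |a p * (a 0 + a 1 + a 2)| := abs_sub _ _
      _ = 2 * |a p * a p| + |a p * (a 0 + a 1 + a 2)| := by
          rw [abs_mul, abs_two, pow_two]
      _ ≤ 2 * (‖a‖ * ‖a‖) + ‖a‖ * (3 * ‖a‖) := by linarith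
      _ = 5 * ‖a‖ ^ 2 := by ring
  · calc |a p * a q| ≤ ‖a‖ * ‖a‖ := hpq
      _ = 1 * ‖a‖ ^ 2 := by ring
      _ ≤ 5 * ‖a‖ ^ 2 := by nlinarith

/-! ## Rank-3 polarisation over the ten cubic-unisolvent impulses `udir` -/

/-- The rank-3 polarisation coefficients of `y^{⊗3}` over `udir` (cubic in `y`; the coefficients of
`AdaptedWeightCLTNegative.tpow_three_polarization`, listed in the order of `udir`). -/
def c3coef (a : V3) : Fin 10 → ℝ :=
  ![a 0 ^ 3 - a 0 * (‖a‖ ^ 2 - a 0 ^ 2) + a 0 * a 1 * a 2,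
    a 1 ^ 3 - a 1 * (‖a‖ ^ 2 - a 1 ^ 2) + a 0 * a 1 * a 2,
    a 2 ^ 3 - a 2 * (‖a‖ ^ 2 - a 2 ^ 2) + a 0 * a 1 * a 2,
    (a 0 ^ 2 * a 1 + a 0 * a 1 ^ 2) / 2 - a 0 * a 1 * a 2,
    (a 0 ^ 2 * a 2 + a 0 * a 2 ^ 2) / 2 - a 0 * a 1 * a 2,
    (a 1 ^ 2 * a 2 + a 1 * a 2 ^ 2) / 2 - a 0 * a 1 * a 2,
    a 0 * a 1 * (a 1 - a 0) / 2,
    a 0 * a 2 * (a 2 - a 0) / 2,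
    a 1 * a 2 * (a 2 - a 1) / 2,
    a 0 * a 1 * a 2]

/-- **Rank-3 polarisation over `udir`.** `y^{⊗3} = Σ_p c₃(y)_p • (udir p)^{⊗3}` — the identity
`AdaptedWeightCLTNegative.tpow_three_polarization` as ONE sum over the ten probe impulses of `cd3x`,
so that by linearity of the transport the ten cubic clouds of `cd3x` control `𝒯(δ_k y_k^{⊗3})`. -/
theorem tpow_three_eq_sum_udir (a : V3) :
    tpow 3 a = ∑ p : Fin 10, c3coef a p • tpow 3 (udir p) := by
  rw [tpow_three_polarization a, Fin.sum_univ_three]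
  simp only [Fin.sum_univ_succ, Fin.sum_univ_zero, c3coef, udir, Matrix.cons_val_zero,
    Matrix.cons_val_succ, add_zero]
  abel

/-- A product of three norm-bounded reals is at most the cube of the norm. -/
theorem abs_mul_three_le {a : V3} {x₁ x₂ x₃ : ℝ} (h₁ : |x₁| ≤ ‖a‖) (h₂ : |x₂| ≤ ‖a‖)
    (h₃ : |x₃| ≤ ‖a‖) : |x₁ * x₂ * x₃| ≤ ‖a‖ ^ 3 := by
  have hn := norm_nonneg a
  rw [abs_mul, abs_mul]
  calc |x₁| * |x₂| * |x₃| ≤ ‖a‖ * ‖a‖ * ‖a‖ :=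
        mul_le_mul (mul_le_mul h₁ h₂ (abs_nonneg _) hn) h₃ (abs_nonneg _) (mul_nonneg hn hn)
    _ = ‖a‖ ^ 3 := by ring

/-- The rank-3 polarisation coefficients are `≤ 3‖y‖³`. -/
theorem abs_c3coef_le (a : V3) (p : Fin 10) : |c3coef a p| ≤ 3 * ‖a‖ ^ 3 := by
  have hn := norm_nonneg a
  have hco : ∀ i : Fin 3, |a i| ≤ ‖a‖ := fun i => by
    rw [← Real.norm_eq_abs]; exact PiLp.norm_apply_le a i
  have h3 : 0 ≤ ‖a‖ ^ 3 := pow_nonneg hn 3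
  have h012 : |a 0 * a 1 * a 2| ≤ ‖a‖ ^ 3 := abs_mul_three_le (hco 0) (hco 1) (hco 2)
  -- the diagonal pattern `y_c³ − y_c (‖y‖² − y_c²) + y₀y₁y₂`
  have hdiag : ∀ c : Fin 3, |a c ^ 3 - a c * (‖a‖ ^ 2 - a c ^ 2) + a 0 * a 1 * a 2| ≤ 3 * ‖a‖ ^ 3 := by
    intro c
    have hc := hco c
    have hc3 : |a c ^ 3| ≤ ‖a‖ ^ 3 := by
      rw [show a c ^ 3 = a c * a c * a c by ring]; exact abs_mul_three_le hc hc hc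
    have hsq : a c ^ 2 ≤ ‖a‖ ^ 2 := by
      have := abs_le.1 hc
      nlinarith
    have hmid : |a c * (‖a‖ ^ 2 - a c ^ 2)| ≤ ‖a‖ ^ 3 := by
      rw [abs_mul, abs_of_nonneg (sub_nonneg.2 hsq)]
      calc |a c| * (‖a‖ ^ 2 - a c ^ 2) ≤ ‖a‖ * ‖a‖ ^ 2 :=
            mul_le_mul hc (by nlinarith [sq_nonneg (a c)]) (sub_nonneg.2 hsq) hn
        _ = ‖a‖ ^ 3 := by ring
    calc |a c ^ 3 - a c * (‖a‖ ^ 2 - a c ^ 2) + a 0 * a 1 * a 2|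
        ≤ |a c ^ 3 - a c * (‖a‖ ^ 2 - a c ^ 2)| + |a 0 * a 1 * a 2| := abs_add_le _ _
      _ ≤ (|a c ^ 3| + |a c * (‖a‖ ^ 2 - a c ^ 2)|) + |a 0 * a 1 * a 2| := by
          gcongr; exact abs_sub _ _
      _ ≤ (‖a‖ ^ 3 + ‖a‖ ^ 3) + ‖a‖ ^ 3 := by gcongr
      _ = 3 * ‖a‖ ^ 3 := by ring
  -- the pattern `(y_c² y_d + y_c y_d²)/2 − y₀y₁y₂`
  have hpair : ∀ c d : Fin 3,
      |(a c ^ 2 * a d + a c * a d ^ 2) / 2 - a 0 * a 1 * a 2| ≤ 3 * ‖a‖ ^ 3 := by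
    intro c d
    have hc := hco c
    have hd := hco d
    have e1 : |a c ^ 2 * a d| ≤ ‖a‖ ^ 3 := by
      rw [show a c ^ 2 * a d = a c * a c * a d by ring]; exact abs_mul_three_le hc hc hd
    have e2 : |a c * a d ^ 2| ≤ ‖a‖ ^ 3 := by
      rw [show a c * a d ^ 2 = a c * a d * a d by ring]; exact abs_mul_three_le hc hd hd
    calc |(a c ^ 2 * a d + a c * a d ^ 2) / 2 - a 0 * a 1 * a 2|
        ≤ |(a c ^ 2 * a d + a c * a d ^ 2) / 2| + |a 0 * a 1 * a 2| := abs_sub _ _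
      _ = (|a c ^ 2 * a d + a c * a d ^ 2|) / 2 + |a 0 * a 1 * a 2| := by
          rw [abs_div, abs_two]
      _ ≤ (|a c ^ 2 * a d| + |a c * a d ^ 2|) / 2 + |a 0 * a 1 * a 2| := by
          gcongr; exact abs_add_le _ _
      _ ≤ (‖a‖ ^ 3 + ‖a‖ ^ 3) / 2 + ‖a‖ ^ 3 := by gcongr
      _ = 2 * ‖a‖ ^ 3 := by ring
      _ ≤ 3 * ‖a‖ ^ 3 := by linarith [h3]
  -- the pattern `y_c y_d (y_d − y_c)/2`
  have hdiff : ∀ c d : Fin 3, |a c * a d * (a d - a c) / 2| ≤ 3 * ‖a‖ ^ 3 := by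
    intro c d
    have hc := hco c
    have hd := hco d
    have e1 : |a c * a d * a d| ≤ ‖a‖ ^ 3 := abs_mul_three_le hc hd hd
    have e2 : |a c * a d * a c| ≤ ‖a‖ ^ 3 := abs_mul_three_le hc hd hc
    calc |a c * a d * (a d - a c) / 2| = |a c * a d * a d - a c * a d * a c| / 2 := by
          rw [abs_div, abs_two]; ring_nf
      _ ≤ (|a c * a d * a d| + |a c * a d * a c|) / 2 := by gcongr; exact abs_sub _ _
      _ ≤ (‖a‖ ^ 3 + ‖a‖ ^ 3) / 2 := by gcongr
      _ = ‖a‖ ^ 3 := by ring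
      _ ≤ 3 * ‖a‖ ^ 3 := by linarith [h3]
  have hlast : |a 0 * a 1 * a 2| ≤ 3 * ‖a‖ ^ 3 := h012.trans (by linarith [h3])
  fin_cases p
  · exact hdiag 0
  · exact hdiag 1
  · exact hdiag 2
  · exact hpair 0 1
  · exact hpair 0 2
  · exact hpair 1 2
  · exact hdiff 0 1
  · exact hdiff 0 2
  · exact hdiff 1 2
  · exact hlast

end

end PastDamping
end Summit.AtomisticToContinuum.HydrodynamicLimit.Theorems.ContactSourceDuhamel.TimeLocal
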